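import Summits.SmoothPoincare4.SmoothPoincare4.Theses.EntropyRung
import Summits.SmoothPoincare4.SmoothPoincare4.Theorems.EntropyRungSubcylindricalExistenceSphereSideClauseAux
import HarnessLib

/-!
# The cap side of the flat-gauge gluing is a round sphere: the `ψ_K`-weighted clause at level
`log 6 − 2` (stub `stub_sphereSideClause`, S2, line `green-blowup-conformal-entropy`, crux
`EntropyRung.SubcylindricalExistence`, item stmt-SmoothPoincare4-10871)

Let `(g, p, G)` be Green data on a closed 4-manifold of the summit binder (`G` smooth and positive
off `p`, `R_g G − 6 Δ_g G = 0` off `p`) with `R_g ≥ 0`, in Schoen's flat gauge at `p`: the extended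
chart `φ` at `p` inverts to a `g`-isometry on the closed ball `B̄(y₀, r)` (`y₀ = φ p`) and
`G ∘ φ⁻¹ = a/‖y − y₀‖²` on the punctured ball. For `K > 0` let `ψ` be smooth with
`ψ = 4KG/(4K+G)` off `p` and `ψ(p) = 4K`. Assuming, BY TEXT, the flat-chart gradient identity (S0),
the flat-chart integration identity (S0b) and the RoundBound on `ℝ⁴` in stereographic coordinates
(S1), we prove: for every `τ > 0` and every smooth `v` supported in the open chart ball with
`∫ (4πτ)⁻² v² ψ⁴ dV_g = 1`,
`log 6 − 2 ≤ ∫ [τ(ψ⁻³ L_g ψ · v² + 4 ψ⁻² |∇v|²_g) − v² log v² − 4 v²] (4πτ)⁻² ψ⁴ dV_g`,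
`L_g ψ = R_g ψ − 6 Δ_g ψ`.

Proof. In the chart, `ψ ∘ φ⁻¹ (y) = 4Ka/(4K‖y − y₀‖² + a) = ρ u_l(y − y₀)` with `l² = 16K/a`,
`ρ² = aK`, `u_l(z) = 4l/(l²‖z‖² + 4)` (so `ψ² g` is the round sphere of radius `ρ` in stereographic
coordinates). Off `p`, `ψ = θ ∘ G` with the Möbius profile `θ(s) = 4K − 16K²/(4K+s)`, so the chain
rule `Δ_g(θ∘G) = θ''(G)|∇G|² + θ'(G) Δ_g G` (`dalembertian_real_comp`), the Green equation
`6 Δ_g G = R_g G`, `θ(s) − s θ'(s) = 4Ks²/(4K+s)² ≥ 0`, `R_g ≥ 0` and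
`|∇G|²_g = ‖∇(a/‖·−y₀‖²)‖² = 4a²/‖y−y₀‖⁶` (S0) give `ψ⁻³ L_g ψ ≥ 12/(aK) = 12/ρ²` on the
punctured ball; the point `p` is `dV_g`-null (chart formula over a Lebesgue-null singleton). The
integrand vanishes off the closed chart ball, where `dV_g` is Lebesgue measure (S0b) and
`|∇v|²_g = ‖∇(v∘φ⁻¹)‖²` (S0); after the translation `y ↦ y − y₀` the `R`-free functional is
exactly the `ℝ⁴`-functional of S1 at scale `τ/ρ²` for the compactly supported smooth extension of
`v ∘ φ⁻¹`, and the `R`-term only helps. References: Schoen 1984 (flat conformal gauge and the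
Green function blow-up); Lee–Parker 1987, §3 (stereographic coordinates, `dV = u⁴ dy`); Perelman
2002, §3 (the `𝒲`-functional). [folklore]
-/

noncomputable section

-- the registered namespace `Summit.SmoothPoincare4.SmoothPoincare4.Theorems` repeats a component
set_option linter.dupNamespace false

open scoped Manifold ContDiff Topology RealInnerProductSpace
open Set Filter MeasureTheory
open Literature.Geometry.Lorentzian Literature.Geometry.Riemannian

namespace Summit.SmoothPoincare4.SmoothPoincare4.Theorems

namespace SphereSideClause

/-! ### The weight identity of the normalisation -/

/-- The weight algebra of the substitution: for `l² = 16K/a`, `u_l = l·4/(l² m + 4)` and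
`Ψ = 4Ka/(4Km + a)` one has `(4π τ/(aK))^{-2} u_l⁴ = (4πτ)^{-2} Ψ⁴`. [folklore] -/
theorem weight_identity₀ {K a τ m : ℝ} (hK : 0 < K) (ha : 0 < a) (hτ : 0 < τ) (hm : 0 ≤ m)
    {l : ℝ} (hl2 : l ^ 2 = 16 * K / a) :
    (4 * Real.pi * (τ / (a * K))) ^ (-(4 : ℝ) / 2) * (l * (4 / (l ^ 2 * m + 4))) ^ 4 =
      (4 * Real.pi * τ) ^ (-(4 : ℝ) / 2) * (4 * K * a / (4 * K * m + a)) ^ 4 := by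
  rw [rpow_neg_four_half (by positivity), rpow_neg_four_half (by positivity)]
  have e1 : (l * (4 / (l ^ 2 * m + 4))) ^ 4 = (l ^ 2) ^ 2 * (4 / (l ^ 2 * m + 4)) ^ 4 := by ring
  rw [e1, hl2]
  have hpi := Real.pi_pos
  field_simp
  ring

/-! ### Transport through the flat chart and continuity of the densities -/

/-- Transport of an integral from the manifold to `ℝ⁴` through a flat chart ball, then a
translation: if `F` vanishes off the set `S` on which the chart identity `hchart` holds, agrees
with `FE` along the chart on the closed ball and `FE` vanishes off the ball, then
`∫ F dμ = ∫ FE(z + y₀) dz`. [folklore] -/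
theorem transfer {M : Type*} [TopologicalSpace M] [MeasurableSpace M] {μ : Measure M} {S : Set M}
    {e : EuclideanSpace ℝ (Fin 4) → M} {y₀ : EuclideanSpace ℝ (Fin 4)} {r : ℝ}
    (hchart : ∀ F : M → ℝ, Continuous F →
      ∫ x in S, F x ∂μ = ∫ y in Metric.closedBall y₀ r, F (e y))
    {F : M → ℝ} {FE : EuclideanSpace ℝ (Fin 4) → ℝ} (hF : Continuous F)
    (hF0 : ∀ x ∉ S, F x = 0) (hFE : ∀ y ∈ Metric.closedBall y₀ r, F (e y) = FE y)
    (hFE0 : ∀ y ∉ Metric.closedBall y₀ r, FE y = 0) :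
    ∫ x, F x ∂μ = ∫ z, FE (z + y₀) := by
  rw [integral_add_right_eq_self FE y₀, ← setIntegral_eq_integral_of_forall_compl_eq_zero hF0,
    hchart F hF, ← setIntegral_eq_integral_of_forall_compl_eq_zero hFE0]
  exact setIntegral_congr_fun measurableSet_closedBall hFE

/-- Continuity of the `ψ`-weighted Perelman density built from continuous pieces. [folklore] -/
theorem continuous_density {X : Type*} [TopologicalSpace X] {ρ w q ψ : X → ℝ} (hρ : Continuous ρ)
    (hw : Continuous w) (hq : Continuous q) (hψ : Continuous ψ) (hψ0 : ∀ x, ψ x ≠ 0) (τ c : ℝ) :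
    Continuous fun x ↦ (τ * (ρ x * w x ^ 2 + 4 * ((ψ x)⁻¹ ^ 2 * q x))
      - w x ^ 2 * Real.log (w x ^ 2) - 4 * w x ^ 2) * (c * ψ x ^ 4) := by
  have hlog : Continuous fun x ↦ w x ^ 2 * Real.log (w x ^ 2) :=
    Real.continuous_mul_log.comp (hw.pow 2)
  have hinv : Continuous fun x ↦ (ψ x)⁻¹ := hψ.inv₀ hψ0
  exact ((((continuous_const.mul ((hρ.mul (hw.pow 2)).add
    (continuous_const.mul ((hinv.pow 2).mul hq)))).sub hlog).sub
    (continuous_const.mul (hw.pow 2))).mul (continuous_const.mul (hψ.pow 4)))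

/-! ### The clause on the cap side -/

/-- **The cap side is a round sphere (workhorse form of `stub_sphereSideClause`).** See the module
docstring; `h0`, `h0b`, `h1` are the by-text statements S0, S0b, S1 of the skeleton. [folklore] -/
theorem sphereSideClause'
    (h0 : ∀ (M : Type) [TopologicalSpace M] [T2Space M] [SecondCountableTopology M]
      [ChartedSpace (EuclideanSpace ℝ (Fin 4)) M] [IsManifold (𝓡 4) ∞ M] [CompactSpace M]
      [T3Space M] [MeasurableSpace M] [BorelSpace M]
      (g : PseudoRiemannianMetric (𝓡 4) ∞ (EuclideanSpace ℝ (Fin 4)) (TangentSpace (𝓡 4) : M → Type _))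
      (p : M) (y : EuclideanSpace ℝ (Fin 4)), y ∈ (extChartAt (𝓡 4) p).target →
      (∀ X W : EuclideanSpace ℝ (Fin 4),
        g.val ((extChartAt (𝓡 4) p).symm y)
          (mfderiv 𝓘(ℝ, EuclideanSpace ℝ (Fin 4)) (𝓡 4) (extChartAt (𝓡 4) p).symm y X)
          (mfderiv 𝓘(ℝ, EuclideanSpace ℝ (Fin 4)) (𝓡 4) (extChartAt (𝓡 4) p).symm y W) = ⟪X, W⟫) →
      ∀ f : M → ℝ, MDifferentiableAt (𝓡 4) 𝓘(ℝ, ℝ) f ((extChartAt (𝓡 4) p).symm y) →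
        g.gradSq f ((extChartAt (𝓡 4) p).symm y) = ‖gradient (f ∘ (extChartAt (𝓡 4) p).symm) y‖ ^ 2)
    (h0b : ∀ (M : Type) [TopologicalSpace M] [T2Space M] [SecondCountableTopology M]
      [ChartedSpace (EuclideanSpace ℝ (Fin 4)) M] [IsManifold (𝓡 4) ∞ M] [CompactSpace M]
      [T3Space M] [MeasurableSpace M] [BorelSpace M]
      (g : PseudoRiemannianMetric (𝓡 4) ∞ (EuclideanSpace ℝ (Fin 4)) (TangentSpace (𝓡 4) : M → Type _))
      [g.HasLeviCivita] (hg : g.IsRiemannian) (p : M) (r : ℝ), 0 < r →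
      Metric.closedBall (extChartAt (𝓡 4) p p) r ⊆ (extChartAt (𝓡 4) p).target →
      (∀ y ∈ Metric.closedBall (extChartAt (𝓡 4) p p) r, ∀ X W : EuclideanSpace ℝ (Fin 4),
        g.val ((extChartAt (𝓡 4) p).symm y)
          (mfderiv 𝓘(ℝ, EuclideanSpace ℝ (Fin 4)) (𝓡 4) (extChartAt (𝓡 4) p).symm y X)
          (mfderiv 𝓘(ℝ, EuclideanSpace ℝ (Fin 4)) (𝓡 4) (extChartAt (𝓡 4) p).symm y W) = ⟪X, W⟫) →
      ∀ F : M → ℝ, Continuous F →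
        ∫ x in {x | x ∈ (extChartAt (𝓡 4) p).source ∧
            extChartAt (𝓡 4) p x ∈ Metric.closedBall (extChartAt (𝓡 4) p p) r}, F x
            ∂(riemannianMeasure (g.toContMDiffRiemannianMetric hg)) =
          ∫ y in Metric.closedBall (extChartAt (𝓡 4) p p) r, F ((extChartAt (𝓡 4) p).symm y))
    (h1 : ∀ (l : ℝ), 0 < l → ∀ τ : ℝ, 0 < τ → ∀ v : EuclideanSpace ℝ (Fin 4) → ℝ, ContDiff ℝ ∞ v →
      HasCompactSupport v →
      ∫ y, (4 * Real.pi * τ) ^ (-(4 : ℝ) / 2) * (v y) ^ 2 * (l * (4 / (l ^ 2 * ‖y‖ ^ 2 + 4))) ^ 4 = 1 →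
        Real.log 6 - 2 ≤
          ∫ y, (τ * (12 * (v y) ^ 2 + 4 * ((l * (4 / (l ^ 2 * ‖y‖ ^ 2 + 4)))⁻¹ ^ 2 * ‖gradient v y‖ ^ 2))
              - (v y) ^ 2 * Real.log ((v y) ^ 2) - 4 * (v y) ^ 2)
              * ((4 * Real.pi * τ) ^ (-(4 : ℝ) / 2) * (l * (4 / (l ^ 2 * ‖y‖ ^ 2 + 4))) ^ 4))
    {M : Type} [TopologicalSpace M] [T2Space M] [SecondCountableTopology M]
    [ChartedSpace (EuclideanSpace ℝ (Fin 4)) M] [IsManifold (𝓡 4) ∞ M] [CompactSpace M]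
    [T3Space M] [MeasurableSpace M] [BorelSpace M]
    (g : PseudoRiemannianMetric (𝓡 4) ∞ (EuclideanSpace ℝ (Fin 4)) (TangentSpace (𝓡 4) : M → Type _))
    [g.HasLeviCivita] (hg : g.IsRiemannian) (hR : ∀ x, 0 ≤ g.scalarCurvature x)
    {p : M} {G : M → ℝ} (hGs : ContMDiffOn (𝓡 4) 𝓘(ℝ, ℝ) ∞ G {p}ᶜ) (hGpos : ∀ x, x ≠ p → 0 < G x)
    (hGreen : ∀ x, x ≠ p → g.scalarCurvature x * G x - 6 * g.dalembertian G x = 0)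
    {a r : ℝ} (ha : 0 < a) (hr : 0 < r)
    (hball : Metric.closedBall (extChartAt (𝓡 4) p p) r ⊆ (extChartAt (𝓡 4) p).target)
    (hflat : ∀ y ∈ Metric.closedBall (extChartAt (𝓡 4) p p) r, ∀ X W : EuclideanSpace ℝ (Fin 4),
      g.val ((extChartAt (𝓡 4) p).symm y)
        (mfderiv 𝓘(ℝ, EuclideanSpace ℝ (Fin 4)) (𝓡 4) (extChartAt (𝓡 4) p).symm y X)
        (mfderiv 𝓘(ℝ, EuclideanSpace ℝ (Fin 4)) (𝓡 4) (extChartAt (𝓡 4) p).symm y W) = ⟪X, W⟫)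
    (hGchart : ∀ y ∈ Metric.closedBall (extChartAt (𝓡 4) p p) r, y ≠ extChartAt (𝓡 4) p p →
      G ((extChartAt (𝓡 4) p).symm y) = a / ‖y - extChartAt (𝓡 4) p p‖ ^ 2)
    {K : ℝ} (hK : 0 < K) {ψ : M → ℝ} (hψs : ContMDiff (𝓡 4) 𝓘(ℝ, ℝ) ∞ ψ)
    (hψ : ∀ x, x ≠ p → ψ x = 4 * K * G x / (4 * K + G x)) (hψp : ψ p = 4 * K)
    {τ : ℝ} (hτ : 0 < τ) {v : M → ℝ} (hv : ContMDiff (𝓡 4) 𝓘(ℝ, ℝ) ∞ v)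
    (hsupp : tsupport v ⊆ {x | x ∈ (extChartAt (𝓡 4) p).source ∧
      extChartAt (𝓡 4) p x ∈ Metric.ball (extChartAt (𝓡 4) p p) r})
    (hnorm : ∫ x, (4 * Real.pi * τ) ^ (-(4 : ℝ) / 2) * (v x) ^ 2 * (ψ x) ^ 4
      ∂(riemannianMeasure (g.toContMDiffRiemannianMetric hg)) = 1) :
    Real.log 6 - 2 ≤
      ∫ x, (τ * ((ψ x ^ 3)⁻¹ * (g.scalarCurvature x * ψ x - 6 * g.dalembertian ψ x) * (v x) ^ 2
            + 4 * ((ψ x)⁻¹ ^ 2 * g.gradSq v x))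
          - (v x) ^ 2 * Real.log ((v x) ^ 2) - 4 * (v x) ^ 2)
          * ((4 * Real.pi * τ) ^ (-(4 : ℝ) / 2) * (ψ x) ^ 4)
        ∂(riemannianMeasure (g.toContMDiffRiemannianMetric hg)) := by
  have hS0 := h0 M g p
  have hS0b := h0b M g hg p r hr hball hflat
  clear h0 h0b
  /- positivity and continuity -/
  have hψpos : ∀ x, 0 < ψ x := by
    intro x
    by_cases hx : x = p
    · rw [hx, hψp]; positivity
    · rw [hψ x hx]; have := hGpos x hx; positivity
  have hψne : ∀ x, ψ x ≠ 0 := fun x ↦ (hψpos x).ne'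
  have hψc : Continuous ψ := hψs.continuous
  have hvc : Continuous v := hv.continuous
  have hRc : Continuous g.scalarCurvature := g.contMDiff_scalarCurvature.continuous
  have hΔc : Continuous (g.dalembertian ψ) :=
    continuous_dalembertian g (hψs.of_le (WithTop.coe_le_coe.mpr le_top))
  have hQc : Continuous (g.gradSq v) := (contMDiff_gradSq g hv).continuous
  /- the support of `v` -/
  have hsub : tsupport v ⊆ (extChartAt (𝓡 4) p).source := fun x hx ↦ (hsupp hx).1
  have hv0 : ∀ x, x ∉ {x | x ∈ (extChartAt (𝓡 4) p).source ∧
      extChartAt (𝓡 4) p x ∈ Metric.closedBall (extChartAt (𝓡 4) p p) r} →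
      v x = 0 ∧ g.gradSq v x = 0 := by
    intro x hx
    have hx' : x ∉ tsupport v := fun h ↦
      hx ⟨(hsupp h).1, Metric.ball_subset_closedBall (hsupp h).2⟩
    refine ⟨image_eq_zero_of_notMem_tsupport hx', ?_⟩
    have hev : v =ᶠ[𝓝 x] fun _ ↦ (0 : ℝ) := notMem_tsupport_iff_eventuallyEq.1 hx'
    rw [show g.gradSq v x = g.gradSq (fun _ : M ↦ (0 : ℝ)) x by
      simp only [PseudoRiemannianMetric.gradSq, mvfderiv_congr_of_eventuallyEq hev]]
    exact g.gradSq_const 0 x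
  have himg : extChartAt (𝓡 4) p '' tsupport v ⊆ Metric.ball (extChartAt (𝓡 4) p p) r := by
    rintro _ ⟨x, hx, rfl⟩
    exact (hsupp hx).2
  /- the chart extension of `v` -/
  have hVcd := chartExt_contDiff p hv hsub
  have hVcs := chartExt_hasCompactSupport p hsub
  have hVapply : ∀ y ∈ Metric.closedBall (extChartAt (𝓡 4) p p) r,
      (extChartAt (𝓡 4) p).target.indicator (v ∘ (extChartAt (𝓡 4) p).symm) y =
        v ((extChartAt (𝓡 4) p).symm y) := fun y hy ↦ indicator_of_mem (hball hy) _
  have hVgrad : ∀ y ∈ Metric.closedBall (extChartAt (𝓡 4) p p) r,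
      g.gradSq v ((extChartAt (𝓡 4) p).symm y) =
        ‖gradient ((extChartAt (𝓡 4) p).target.indicator (v ∘ (extChartAt (𝓡 4) p).symm))
          y‖ ^ 2 := by
    intro y hy
    rw [hS0 y (hball hy) (hflat y hy) v (hv.mdifferentiableAt (by simp)),
      (chartExt_eventuallyEq p v (hball hy)).gradient_eq]
  have hVzero : ∀ y, y ∉ Metric.closedBall (extChartAt (𝓡 4) p p) r →
      (extChartAt (𝓡 4) p).target.indicator (v ∘ (extChartAt (𝓡 4) p).symm) y = 0 ∧
      gradient ((extChartAt (𝓡 4) p).target.indicator (v ∘ (extChartAt (𝓡 4) p).symm)) y = 0 :=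
    fun y hy ↦ chartExt_eq_zero p hsub fun h ↦ hy (Metric.ball_subset_closedBall (himg h))
  /- `ψ` in the chart and the curvature weight -/
  have hψchart : ∀ y ∈ Metric.closedBall (extChartAt (𝓡 4) p p) r,
      ψ ((extChartAt (𝓡 4) p).symm y) =
        4 * K * a / (4 * K * ‖y - extChartAt (𝓡 4) p p‖ ^ 2 + a) :=
    fun y hy ↦ psi_chart p ha hball hGchart hψ hψp hy
  have hcurv : ∀ y ∈ Metric.ball (extChartAt (𝓡 4) p p) r, y ≠ extChartAt (𝓡 4) p p →
      12 / (a * K) ≤ (ψ ((extChartAt (𝓡 4) p).symm y) ^ 3)⁻¹ *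
        (g.scalarCurvature ((extChartAt (𝓡 4) p).symm y) * ψ ((extChartAt (𝓡 4) p).symm y) -
          6 * g.dalembertian ψ ((extChartAt (𝓡 4) p).symm y)) :=
    fun y hy hy0 ↦ curv_bound g hS0 hR hGs hGpos hGreen ha hball hflat hGchart hK hψ hy hy0
  have hps : p ∈ (extChartAt (𝓡 4) p).source := mem_extChartAt_source p
  /- `p` is `dV_g`-null -/
  have hae : ∀ᵐ x ∂(riemannianMeasure (g.toContMDiffRiemannianMetric hg)), x ≠ p := by
    have hpt : riemannianMeasure (g.toContMDiffRiemannianMetric hg) {p} = 0 := by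
      rw [riemannianMeasure_eq_integral_sqrt_det_holds (g.toContMDiffRiemannianMetric hg) p
        (measurableSet_singleton p) (singleton_subset_iff.2 hps), image_singleton]
      exact setLIntegral_measure_zero _ _ (measure_singleton _)
    have := measure_eq_zero_iff_ae_notMem.1 hpt
    filter_upwards [this] with x hx
    simpa using hx
  clear hS0 hflat
  /- abstract the chart and the extension -/
  generalize hV : (extChartAt (𝓡 4) p).target.indicator (v ∘ (extChartAt (𝓡 4) p).symm) = V at *
  generalize hφ : extChartAt (𝓡 4) p = φ at *
  /- the dilation parameter -/
  obtain ⟨l, hl, hl2⟩ : ∃ l : ℝ, 0 < l ∧ l ^ 2 = 16 * K / a :=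
    ⟨Real.sqrt (16 * K / a), Real.sqrt_pos.2 (by positivity), Real.sq_sqrt (by positivity)⟩
  have hτ' : 0 < τ / (a * K) := by positivity
  /- Step 1: the normalisation transported to `ℝ⁴` -/
  have hnormE : ∫ z : EuclideanSpace ℝ (Fin 4), (4 * Real.pi * (τ / (a * K))) ^ (-(4 : ℝ) / 2) *
      (V (z + φ p)) ^ 2 * (l * (4 / (l ^ 2 * ‖z‖ ^ 2 + 4))) ^ 4 = 1 := by
    have hT := transfer (F := fun x ↦ (4 * Real.pi * τ) ^ (-(4 : ℝ) / 2) * (v x) ^ 2 * (ψ x) ^ 4)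
      (FE := fun y ↦ (4 * Real.pi * τ) ^ (-(4 : ℝ) / 2) * (V y) ^ 2 *
        (4 * K * a / (4 * K * ‖y - φ p‖ ^ 2 + a)) ^ 4) hS0b
      (by fun_prop) (fun x hx ↦ by simp [(hv0 x hx).1])
      (fun y hy ↦ by simp only [hVapply y hy, hψchart y hy])
      (fun y hy ↦ by simp [(hVzero y hy).1])
    rw [hnorm] at hT
    rw [hT]
    refine integral_congr_ae (Eventually.of_forall fun z ↦ ?_)
    simp only [add_sub_cancel_right]
    have hw := weight_identity₀ (m := ‖z‖ ^ 2) hK ha hτ (sq_nonneg _) hl2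
    calc (4 * Real.pi * (τ / (a * K))) ^ (-(4 : ℝ) / 2) * (V (z + φ p)) ^ 2 *
          (l * (4 / (l ^ 2 * ‖z‖ ^ 2 + 4))) ^ 4
        = (V (z + φ p)) ^ 2 * ((4 * Real.pi * (τ / (a * K))) ^ (-(4 : ℝ) / 2) *
          (l * (4 / (l ^ 2 * ‖z‖ ^ 2 + 4))) ^ 4) := by ring
      _ = (V (z + φ p)) ^ 2 * ((4 * Real.pi * τ) ^ (-(4 : ℝ) / 2) *
          (4 * K * a / (4 * K * ‖z‖ ^ 2 + a)) ^ 4) := by rw [hw]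
      _ = _ := by ring
  /- Step 2: RoundBound on `ℝ⁴` for the translated extension -/
  have hVtc : ContDiff ℝ ∞ fun z : EuclideanSpace ℝ (Fin 4) ↦ V (z + φ p) :=
    hVcd.comp (contDiff_id.add contDiff_const)
  have hVts : HasCompactSupport fun z : EuclideanSpace ℝ (Fin 4) ↦ V (z + φ p) :=
    hVcs.comp_homeomorph (Homeomorph.addRight (φ p))
  have hS1 := h1 l hl (τ / (a * K)) hτ' (fun z ↦ V (z + φ p)) hVtc hVts hnormE
  /- Step 3: the `R`-frozen functional on `M` equals the S1 functional -/
  have hΦ'c : Continuous fun x ↦ (τ * (12 / (a * K) * v x ^ 2 + 4 * ((ψ x)⁻¹ ^ 2 * g.gradSq v x))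
      - v x ^ 2 * Real.log (v x ^ 2) - 4 * v x ^ 2) *
      ((4 * Real.pi * τ) ^ (-(4 : ℝ) / 2) * ψ x ^ 4) :=
    continuous_density continuous_const hvc hQc hψc hψne τ _
  have hT2 := transfer
    (F := fun x ↦ (τ * (12 / (a * K) * v x ^ 2 + 4 * ((ψ x)⁻¹ ^ 2 * g.gradSq v x))
      - v x ^ 2 * Real.log (v x ^ 2) - 4 * v x ^ 2) *
      ((4 * Real.pi * τ) ^ (-(4 : ℝ) / 2) * ψ x ^ 4))
    (FE := fun y ↦ (τ * (12 / (a * K) * V y ^ 2 +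
        4 * ((4 * K * a / (4 * K * ‖y - φ p‖ ^ 2 + a))⁻¹ ^ 2 * ‖gradient V y‖ ^ 2))
      - V y ^ 2 * Real.log (V y ^ 2) - 4 * V y ^ 2) *
        ((4 * Real.pi * τ) ^ (-(4 : ℝ) / 2) * (4 * K * a / (4 * K * ‖y - φ p‖ ^ 2 + a)) ^ 4))
    hS0b hΦ'c
    (fun x hx ↦ by simp [(hv0 x hx).1, (hv0 x hx).2])
    (fun y hy ↦ by simp only [hVapply y hy, hψchart y hy, hVgrad y hy])
    (fun y hy ↦ by simp [(hVzero y hy).1, (hVzero y hy).2])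
  have hS1' : Real.log 6 - 2 ≤
      ∫ x, (τ * (12 / (a * K) * v x ^ 2 + 4 * ((ψ x)⁻¹ ^ 2 * g.gradSq v x))
        - v x ^ 2 * Real.log (v x ^ 2) - 4 * v x ^ 2) *
        ((4 * Real.pi * τ) ^ (-(4 : ℝ) / 2) * ψ x ^ 4)
        ∂(riemannianMeasure (g.toContMDiffRiemannianMetric hg)) := by
    rw [hT2]
    refine hS1.trans_eq (integral_congr_ae (Eventually.of_forall fun z ↦ ?_))
    simp only [gradient_comp_add_right V (φ p) z, add_sub_cancel_right]
    exact weight_identity (m := ‖z‖ ^ 2) hK ha hτ (sq_nonneg _) hl2 _ _ _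
  /- Step 4: the `R`-term only helps -/
  refine hS1'.trans (integral_mono_ae (EntropyLocalisation.integrable_of_continuous g hg hΦ'c)
    (EntropyLocalisation.integrable_of_continuous g hg ?_) ?_)
  · exact continuous_density (((hψc.pow 3).inv₀ fun x ↦ pow_ne_zero 3 (hψne x)).mul
      ((hRc.mul hψc).sub (continuous_const.mul hΔc))) hvc hQc hψc hψne τ _
  · filter_upwards [hae] with x hxp
    have hdiff : (τ * ((ψ x ^ 3)⁻¹ * (g.scalarCurvature x * ψ x - 6 * g.dalembertian ψ x) * v x ^ 2
          + 4 * ((ψ x)⁻¹ ^ 2 * g.gradSq v x)) - v x ^ 2 * Real.log (v x ^ 2) - 4 * v x ^ 2)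
          * ((4 * Real.pi * τ) ^ (-(4 : ℝ) / 2) * ψ x ^ 4)
        - (τ * (12 / (a * K) * v x ^ 2 + 4 * ((ψ x)⁻¹ ^ 2 * g.gradSq v x))
          - v x ^ 2 * Real.log (v x ^ 2) - 4 * v x ^ 2) *
          ((4 * Real.pi * τ) ^ (-(4 : ℝ) / 2) * ψ x ^ 4)
        = τ * ((ψ x ^ 3)⁻¹ * (g.scalarCurvature x * ψ x - 6 * g.dalembertian ψ x) - 12 / (a * K))
          * v x ^ 2 * ((4 * Real.pi * τ) ^ (-(4 : ℝ) / 2) * ψ x ^ 4) := by ring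
    rw [← sub_nonneg, hdiff]
    by_cases hvx : v x = 0
    · rw [hvx]
      simp
    · have hxt : x ∈ tsupport v := subset_tsupport v hvx
      obtain ⟨hxs, hxb⟩ := hsupp hxt
      have hy0 : φ x ≠ φ p := fun h ↦ hxp (φ.injOn hxs hps h)
      have hcx := hcurv (φ x) hxb hy0
      rw [φ.left_inv hxs] at hcx
      have hc4 : 0 ≤ (4 * Real.pi * τ) ^ (-(4 : ℝ) / 2) * ψ x ^ 4 := by positivity
      exact mul_nonneg (mul_nonneg (mul_nonneg hτ.le (sub_nonneg.2 hcx)) (sq_nonneg _)) hc4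

end SphereSideClause

open SphereSideClause in
/-- **Stub S2 of line `green-blowup-conformal-entropy` (the cap side is a round sphere).** In the
flat gauge at `p` (radius `r`, `G = a/‖y−y₀‖²` on the ball), for `R_g ≥ 0`, Green data
`(g, p, G)`, `K > 0` and a smooth `ψ` with `ψ = 4KG/(4K+G)` off `p`, `ψ(p) = 4K`, and assuming by
text the flat-chart gradient identity (S0), the flat-chart integration identity (S0b) and the
RoundBound on `ℝ⁴` in stereographic coordinates (S1): for every `τ > 0` and every smooth `v`
supported in the open chart ball with `∫ (4πτ)⁻² v² ψ⁴ dV_g = 1`,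
`log 6 − 2 ≤ ∫ [τ(ψ⁻³ L_g ψ · v² + 4ψ⁻²|∇v|²_g) − v² log v² − 4v²] (4πτ)⁻² ψ⁴ dV_g`.
Schoen 1984 (flat conformal gauge); Lee–Parker 1987 §3; Perelman 2002 §3. [folklore] -/
theorem stub_sphereSideClause :
    (∀ (M : Type) [TopologicalSpace M] [T2Space M] [SecondCountableTopology M]
      [ChartedSpace (EuclideanSpace ℝ (Fin 4)) M] [IsManifold (𝓡 4) ∞ M] [CompactSpace M]
      [T3Space M] [MeasurableSpace M] [BorelSpace M]
      (g : PseudoRiemannianMetric (𝓡 4) ∞ (EuclideanSpace ℝ (Fin 4)) (TangentSpace (𝓡 4) : M → Type _))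
      (p : M) (y : EuclideanSpace ℝ (Fin 4)), y ∈ (extChartAt (𝓡 4) p).target →
      (∀ X W : EuclideanSpace ℝ (Fin 4),
        g.val ((extChartAt (𝓡 4) p).symm y)
          (mfderiv 𝓘(ℝ, EuclideanSpace ℝ (Fin 4)) (𝓡 4) (extChartAt (𝓡 4) p).symm y X)
          (mfderiv 𝓘(ℝ, EuclideanSpace ℝ (Fin 4)) (𝓡 4) (extChartAt (𝓡 4) p).symm y W) = ⟪X, W⟫) →
      ∀ f : M → ℝ, MDifferentiableAt (𝓡 4) 𝓘(ℝ, ℝ) f ((extChartAt (𝓡 4) p).symm y) →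
        g.gradSq f ((extChartAt (𝓡 4) p).symm y) = ‖gradient (f ∘ (extChartAt (𝓡 4) p).symm) y‖ ^ 2) →
    (∀ (M : Type) [TopologicalSpace M] [T2Space M] [SecondCountableTopology M]
      [ChartedSpace (EuclideanSpace ℝ (Fin 4)) M] [IsManifold (𝓡 4) ∞ M] [CompactSpace M]
      [T3Space M] [MeasurableSpace M] [BorelSpace M]
      (g : PseudoRiemannianMetric (𝓡 4) ∞ (EuclideanSpace ℝ (Fin 4)) (TangentSpace (𝓡 4) : M → Type _))
      [g.HasLeviCivita] (hg : g.IsRiemannian) (p : M) (r : ℝ), 0 < r →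
      Metric.closedBall (extChartAt (𝓡 4) p p) r ⊆ (extChartAt (𝓡 4) p).target →
      (∀ y ∈ Metric.closedBall (extChartAt (𝓡 4) p p) r, ∀ X W : EuclideanSpace ℝ (Fin 4),
        g.val ((extChartAt (𝓡 4) p).symm y)
          (mfderiv 𝓘(ℝ, EuclideanSpace ℝ (Fin 4)) (𝓡 4) (extChartAt (𝓡 4) p).symm y X)
          (mfderiv 𝓘(ℝ, EuclideanSpace ℝ (Fin 4)) (𝓡 4) (extChartAt (𝓡 4) p).symm y W) = ⟪X, W⟫) →
      ∀ F : M → ℝ, Continuous F →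
        ∫ x in {x | x ∈ (extChartAt (𝓡 4) p).source ∧
            extChartAt (𝓡 4) p x ∈ Metric.closedBall (extChartAt (𝓡 4) p p) r}, F x
            ∂(riemannianMeasure (g.toContMDiffRiemannianMetric hg)) =
          ∫ y in Metric.closedBall (extChartAt (𝓡 4) p p) r, F ((extChartAt (𝓡 4) p).symm y)) →
    (∀ (l : ℝ), 0 < l → ∀ τ : ℝ, 0 < τ → ∀ v : EuclideanSpace ℝ (Fin 4) → ℝ, ContDiff ℝ ∞ v →
      HasCompactSupport v →
      ∫ y, (4 * Real.pi * τ) ^ (-(4 : ℝ) / 2) * (v y) ^ 2 * (l * (4 / (l ^ 2 * ‖y‖ ^ 2 + 4))) ^ 4 = 1 →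
        Real.log 6 - 2 ≤
          ∫ y, (τ * (12 * (v y) ^ 2 + 4 * ((l * (4 / (l ^ 2 * ‖y‖ ^ 2 + 4)))⁻¹ ^ 2 * ‖gradient v y‖ ^ 2))
              - (v y) ^ 2 * Real.log ((v y) ^ 2) - 4 * (v y) ^ 2)
              * ((4 * Real.pi * τ) ^ (-(4 : ℝ) / 2) * (l * (4 / (l ^ 2 * ‖y‖ ^ 2 + 4))) ^ 4)) →
    ∀ (M : Type) [TopologicalSpace M] [T2Space M] [SecondCountableTopology M]
      [ChartedSpace (EuclideanSpace ℝ (Fin 4)) M] [IsManifold (𝓡 4) ∞ M] [CompactSpace M]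
      [T3Space M] [MeasurableSpace M] [BorelSpace M]
      (g : PseudoRiemannianMetric (𝓡 4) ∞ (EuclideanSpace ℝ (Fin 4)) (TangentSpace (𝓡 4) : M → Type _))
      [g.HasLeviCivita] (hg : g.IsRiemannian), (∀ x, 0 ≤ g.scalarCurvature x) →
      ∀ (p : M) (G : M → ℝ),
        (ContMDiffOn (𝓡 4) 𝓘(ℝ, ℝ) ∞ G {p}ᶜ ∧ (∀ x, x ≠ p → 0 < G x) ∧
          (∀ x, x ≠ p → g.scalarCurvature x * G x - 6 * g.dalembertian G x = 0) ∧
          Tendsto G (𝓝[≠] p) atTop) →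
      ∀ (a r : ℝ), 0 < a → 0 < r →
        Metric.closedBall (extChartAt (𝓡 4) p p) r ⊆ (extChartAt (𝓡 4) p).target →
        (∀ y ∈ Metric.closedBall (extChartAt (𝓡 4) p p) r, ∀ X W : EuclideanSpace ℝ (Fin 4),
          g.val ((extChartAt (𝓡 4) p).symm y)
            (mfderiv 𝓘(ℝ, EuclideanSpace ℝ (Fin 4)) (𝓡 4) (extChartAt (𝓡 4) p).symm y X)
            (mfderiv 𝓘(ℝ, EuclideanSpace ℝ (Fin 4)) (𝓡 4) (extChartAt (𝓡 4) p).symm y W) = ⟪X, W⟫) →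
        (∀ y ∈ Metric.closedBall (extChartAt (𝓡 4) p p) r, y ≠ extChartAt (𝓡 4) p p →
          G ((extChartAt (𝓡 4) p).symm y) = a / ‖y - extChartAt (𝓡 4) p p‖ ^ 2) →
      ∀ (K : ℝ), 0 < K → ∀ (ψ : M → ℝ), ContMDiff (𝓡 4) 𝓘(ℝ, ℝ) ∞ ψ →
        (∀ x, x ≠ p → ψ x = 4 * K * G x / (4 * K + G x)) → ψ p = 4 * K →
      ∀ τ : ℝ, 0 < τ → ∀ v : M → ℝ, ContMDiff (𝓡 4) 𝓘(ℝ, ℝ) ∞ v →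
        tsupport v ⊆ {x | x ∈ (extChartAt (𝓡 4) p).source ∧
            extChartAt (𝓡 4) p x ∈ Metric.ball (extChartAt (𝓡 4) p p) r} →
        ∫ x, (4 * Real.pi * τ) ^ (-(4 : ℝ) / 2) * (v x) ^ 2 * (ψ x) ^ 4
            ∂(riemannianMeasure (g.toContMDiffRiemannianMetric hg)) = 1 →
          Real.log 6 - 2 ≤
            ∫ x, (τ * ((ψ x ^ 3)⁻¹ * (g.scalarCurvature x * ψ x - 6 * g.dalembertian ψ x) * (v x) ^ 2
                  + 4 * ((ψ x)⁻¹ ^ 2 * g.gradSq v x))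
                - (v x) ^ 2 * Real.log ((v x) ^ 2) - 4 * (v x) ^ 2)
                * ((4 * Real.pi * τ) ^ (-(4 : ℝ) / 2) * (ψ x) ^ 4)
              ∂(riemannianMeasure (g.toContMDiffRiemannianMetric hg)) := by
  intro h0 h0b h1 M _ _ _ _ _ _ _ _ _ g _ hg hR p G hGreen a r ha hr hball hflat hGchart K hK ψ hψs hψ
    hψp τ hτ v hv hsupp hnorm
  exact sphereSideClause' h0 h0b h1 g hg hR hGreen.1 hGreen.2.1 hGreen.2.2.1 ha hr hball hflat
    hGchart hK hψs hψ hψp hτ hv hsupp hnorm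

end Summit.SmoothPoincare4.SmoothPoincare4.Theorems

end
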